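import Literature.Computability.MetaComplexity.BoundedArithSequences
import HarnessLib

/-!
# Query-presentable functions in models of `T₂ⁱ` (Buss 1990, §3, semantically), part 1

Trunk: CplxMeta (G14), topic `Literature/Computability/MetaComplexity`.  Fourth layer of the
bootstrapping inside a model `M ⊨ BASIC + Σᵇ₁-IND + Σᵇᵢ₊₁-IND` (`= T₂ⁱ⁺¹`), serving the proof of
Buss's conservation theorem `Literature.Computability.Complexity.S2_succ_isConservativeOver_T2`
(Buss 1990, Thm. 5) by the Herbrand-saturation route
(`Literature/Computability/Complexity/BoundedArithmeticHerbrand.lean`): the functions that will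
interpret the symbols of the universal conservative extension of `T₂ⁱ⁺¹` (Buss's `Qᵢ₊₁`-definable
functions, Buss 1990, §3, Definition after Thm. 9; = `FP` with a `Σᵖᵢ₊₁` oracle) are introduced
*semantically*, by **binary query presentations**:

* `IsAnswerCode Q S L w` — `w < 2ᴸ` and, for every position `p < L`, the bit of `w` at `p` is
  `1` iff the query `Q w p` holds, where `Q` is *causal* (reads only the bits of `w` above `p`,
  i.e. the answers to the earlier queries); such codes exist and are unique for `Σᵇᵢ₊₁`-definable
  causal `Q` (`exists_answerCode`, `answerCode_unique`: Buss 1990, Thm. 8, via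
  `exists_canonSeqC` with one-bit digits);
* `QPres k n` — a presentation of an `n`-ary function: term functions `L` (number of queries) and
  `S` (length bound), a `Σᵇₖ₊₁`-definable causal query family `Q x̄ w p` and a `Σᵇₖ₊₁`-definable
  output function `OUT x̄ w`; `QPres.eval P x̄ = OUT x̄ (answerCode …)`; `IsQFn k F` — `F` has
  such a presentation (Buss 1990, §3: "`Qᵢ`-definable", with `P^{Σᵖᵢ}`-style sequential
  queries in place of Buss's oracle Turing machines);
* closure properties (Buss 1990, Thm. 9 / Cor. 10 / Thm. 11(a), semantically): every
  `Σᵇₖ₊₁`-definable function is `IsQFn k` (`IsSigmabFn.isQFn`), characteristic functions of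
  `Σᵇₖ₊₁`- and `Πᵇₖ₊₁`-definable predicates (`isQFn_chi`, one query), renaming of arguments,
  post-composition with a `Σᵇₖ₊₁`-definable function, and **composition**
  `x̄ ↦ G(x̄, H x̄)` (`IsQFn.comp₁`: the answer code of the composite is the concatenation of the
  answer code of `H` and, below it, that of `G` at the computed argument — the block lemma
  `IsAnswerCode.block`).

Limited iteration (Buss 1990, Thm. 11(b)) and `Σᵇ`-minimization (Thm. 12) follow in part 2.
All inductions inside `M` are on `Σᵇₖ₊₁`/`Πᵇₖ₊₁`/open predicates with answer codes as
*parameters*; no `Δᵇₖ₊₂`-induction is used (that principle is itself a corollary of the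
conservation theorem, Buss 1990, Cor. 6).

## References

* S. R. Buss, *Axiomatizations and conservation results for fragments of bounded arithmetic*,
  in: Logic and Computation, Contemp. Math. 106, AMS 1990, 57–84: §3 (Thm. 8, Thm. 9, Cor. 10,
  the Definition of `Qᵢ`-definability, Thm. 11).
* S. R. Buss, *Bounded Arithmetic*, Bibliopolis 1986, §2.5–2.6.

## Design choices

* Answers are single bits (`t = 0`, `b = 1` in `IsCanonAtC`), so that all codes use the same
  digit format and blocks of codes are again codes (no recoding); a witness search is then a
  sequence of adaptive yes/no queries (part 2) rather than one greatest-witness digit.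
* `QPres` is data (so that composite presentations can be written down), `IsQFn` the
  `Prop`-valued closure under `∃`; the functions themselves (`chiFn`, compositions, …) are
  ordinary functions on `M`, defined without reference to presentations.
* Hypotheses as in the lower layers: instance arguments `[M ⊨ BASIC]`,
  `[M ⊨ INDScheme (sigmabFormulas 1)]` and an explicit `hIk : M ⊨ INDScheme (sigmabFormulas (k+1))`.
-/

namespace Literature.Computability.MetaComplexity

namespace BASICModel

open FirstOrder FirstOrder.Language

variable {M : Type} [Language.boundedArith.Structure M] [hB : M ⊨ BASIC]
  [hI : M ⊨ INDScheme (sigmabFormulas 1)]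

/-! ## Bits of a code (digit width `1`) -/

section Bits

/-- `pow2B S 1 = 2` as soon as `|S| ≥ 1`. [folklore] -/
theorem pow2B_one {S : M} (hS : 1 ≤ mLen S) : pow2B S 1 = 2 := by
  have h0 : (0 : M) < mLen S := lt_of_lt_of_le zero_lt_one hS
  have := pow2B_add_one (b := S) (k := 0) h0
  rw [zero_add, pow2B_zero, mul_one] at this
  exact this

/-- A bit is `≤ 1` (`|S| ≥ 1`). [folklore] -/
theorem seqEl_one_le_one {S : M} (hS : 1 ≤ mLen S) (w p : M) : seqEl S 1 w p ≤ 1 := by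
  have h := seqEl_lt S 1 w p
  rw [pow2B_one hS, ← one_add_one_eq_two] at h
  exact (lt_add_one_iff' _ _).1 h

/-- A bit is `0` or `1` (`|S| ≥ 1`). [folklore] -/
theorem seqEl_one_eq_zero_or_eq_one {S : M} (hS : 1 ≤ mLen S) (w p : M) :
    seqEl S 1 w p = 0 ∨ seqEl S 1 w p = 1 := by
  rcases eq_or_ne (seqEl S 1 w p) 0 with h | h
  · exact Or.inl h
  · exact Or.inr (le_antisymm (seqEl_one_le_one hS w p) ((one_le_iff_ne_zero' _).2 h))

/-- Bits do not depend on the length bound `S` below both lengths: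
`seqEl S 1 w q = seqEl S' 1 w q` for `q + 1 ≤ |S|, |S'|`. [folklore] -/
theorem seqEl_one_congr {S S' q : M} (hq : q + 1 ≤ mLen S) (hq' : q + 1 ≤ mLen S') (w : M) :
    seqEl S 1 w q = seqEl S' 1 w q := by
  have h1 : 1 ≤ mLen S := le_trans (le_add_left'' 1 q) hq
  have h1' : 1 ≤ mLen S' := le_trans (le_add_left'' 1 q) hq'
  have hqS : q ≤ mLen S := le_trans (le_add_right'' q 1) hq
  have hqS' : q ≤ mLen S' := le_trans (le_add_right'' q 1) hq'
  rw [seqEl, seqEl, digit, digit, mul_one, pow2B_congr hqS hqS', pow2B_one h1, pow2B_one h1']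

/-- Bits of a small code vanish: `w < 2^m`, `m ≤ q ≤ |S|` gives bit `q` of `w` equal to `0`.
[folklore] -/
theorem seqEl_one_eq_zero_of_lt {S m q w : M} (hw : w < pow2B S m) (hm : m ≤ q)
    (hq : q ≤ mLen S) : seqEl S 1 w q = 0 := by
  rw [seqEl, mul_one]
  exact digit_eq_zero_of_lt hw hm hq

/-- Bits above the length bound vanish for a code below `2^{|S|}`… more generally: if
`w < 2^m` with `m ≤ |S|` then every bit of `w` at a position `q ≥ m` is `0`, also for
`q > |S|` (where the clamped `2^q` is `2^{|S|}`). [folklore] -/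
theorem seqEl_one_eq_zero_of_lt' {S m q w : M} (hw : w < pow2B S m) (hmS : m ≤ mLen S)
    (hm : m ≤ q) : seqEl S 1 w q = 0 := by
  rcases le_or_gt q (mLen S) with hq | hq
  · exact seqEl_one_eq_zero_of_lt hw hm hq
  · rw [seqEl, mul_one, digit, pow2B_of_mLen_le hq.le]
    have h0 : w / pow2B S (mLen S) = 0 :=
      (div_eq_zero_iff' (pow2B_pos S _)).2 (lt_of_lt_of_le hw (pow2B_mono S hmS))
    rw [h0, zero_mod']

/-- Bits of a shifted code: bit `q` of `⌊w / 2^m⌋` is bit `q + m` of `w` (`q + m + 1 ≤ |S|`).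
[folklore] -/
theorem seqEl_one_div_pow2B {S m q : M} (h : q + m + 1 ≤ mLen S) (w : M) :
    seqEl S 1 (w / pow2B S m) q = seqEl S 1 w (q + m) := by
  have := seqEl_div_pow2B (S := S) (b := 1) (m := m) (q := q) (by simpa using h) w
  simpa using this

/-- Bits of a truncated code: bit `q` of `w mod 2^m` is bit `q` of `w` for `q < m ≤ |S|`.
[folklore] -/
theorem seqEl_one_mod_pow2B {S m q : M} (hq : q < m) (hm : m ≤ mLen S) (w : M) :
    seqEl S 1 (w % pow2B S m) q = seqEl S 1 w q := by
  have := seqEl_mod_pow2B (S := S) (b := 1) (m := m) (q := q) hq (by simpa using hm) w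
  simpa using this

/-- Extensionality of bits: two codes `< 2ᴸ` with the same bits below `L ≤ |S|` are equal.
[folklore] -/
theorem ext_of_seqEl_one {S L w w' : M} (hL : L ≤ mLen S) (hw : w < pow2B S L)
    (hw' : w' < pow2B S L) (h : ∀ p, p < L → seqEl S 1 w p = seqEl S 1 w' p) : w = w' :=
  ext_of_seqEl (b := 1) (by simpa using hL) (by simpa using hw) (by simpa using hw') h

end Bits

/-! ## Binary answer codes of causal query families -/

section AnswerCodes

variable {k : ℕ}

omit hI in
/-- In a model of `BASIC`, `w < 1` forces `w = 0`. [folklore] -/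
theorem eq_zero_of_lt_one {w : M} (h : w < 1) : w = 0 :=
  le_antisymm ((lt_add_one_iff' w 0).1 (by simpa using h)) bot_le

/-- `IsCausal₁ Q S`: the binary query family `Q w p` ("the `p`-th query about the code `w`")
reads only the bits of `w` at the positions `q` with `p < q < |S|` — the answers to the queries
asked before it (Buss 1990, §3: the `j`-th oracle query depends on the previous answers only).
[cite: BussContempMath1990, §3, Definition of `Qᵢ`-definability] -/
def IsCausal₁ (Q : M → M → Prop) (S : M) : Prop :=
  ∀ w w' p, (∀ q, p < q → q + 1 ≤ mLen S → seqEl S 1 w q = seqEl S 1 w' q) → (Q w p ↔ Q w' p)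

/-- A causal binary query family is a causal query family with one-bit digits. [folklore] -/
theorem IsCausal₁.isCausal {Q : M → M → Prop} {S : M} (h : IsCausal₁ Q S) :
    IsCausal (fun w p _ => Q w p) S 1 :=
  fun w w' p _ hq => h w w' p fun q hpq hqS => hq q hpq (by simpa using hqS)

/-- `IsAnswerCode Q S L w`: `w < 2ᴸ` and for every `p < L` the bit of `w` at position `p` is `1`
iff the query `Q w p` holds (Buss 1990, Thm. 8: `Bit(j, w) = 1 ↔ U(LSP(w, j), j)`).
[cite: BussContempMath1990, Thm. 8] -/
def IsAnswerCode (Q : M → M → Prop) (S L w : M) : Prop :=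
  w < pow2B S L ∧ ∀ p, p < L → (seqEl S 1 w p = 1 ↔ Q w p)

/-- Canonicity of a one-bit digit is the answer-bit condition. [folklore] -/
theorem isCanonAtC_bit_iff {Q : M → M → Prop} {S : M} (hS : 1 ≤ mLen S) (w p : M) :
    IsCanonAtC (fun w p _ => Q w p) 0 S 1 w p ↔ (seqEl S 1 w p = 1 ↔ Q w p) := by
  rcases seqEl_one_eq_zero_or_eq_one hS w p with h0 | h1
  · simp only [IsCanonAtC, h0, ne_eq, not_true_eq_false, zero_add, IsEmpty.forall_iff, and_true,
      zero_ne_one, false_iff]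
    constructor
    · intro h hQ
      have := h 0 le_rfl hQ
      rw [zero_add] at this
      exact (lt_irrefl (0 : M)) (lt_of_lt_of_le zero_lt_one this)
    · intro hQ z _ hz
      exact (hQ hz).elim
  · simp only [IsCanonAtC, h1, ne_eq, one_ne_zero, not_false_eq_true, zero_add, le_refl,
      true_and, forall_const, true_iff]
    constructor
    · exact fun h => h.2
    · intro hQ
      refine ⟨fun z hz _ => by simpa using hz, hQ⟩

/-- **Existence of answer codes** (Buss 1990, Thm. 8, one-bit form): a `Σᵇₖ₊₁`-definable causal
binary query family has an answer code of every length `L ≤ |S|` (`|S| ≥ 1`), in a model of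
`BASIC + Σᵇ₁-IND + Σᵇₖ₊₁-IND`. [cite: BussContempMath1990, Thm. 8] -/
theorem exists_isAnswerCode (hIk : M ⊨ INDScheme (sigmabFormulas (k + 1))) {Q : M → M → Prop}
    (hQ : IsSigmabDef (k + 1) fun v : Fin 2 → M => Q (v 0) (v 1)) {S L : M}
    (hQc : IsCausal₁ Q S) (hS : 1 ≤ mLen S) (hL : L ≤ mLen S) : ∃ w, IsAnswerCode Q S L w := by
  have hD : IsSigmabDef (k + 1) fun u : Fin 3 → M => Q (u 0) (u 1) := hQ.comp ![0, 1]
  have ht : (0 : M) + 1 < pow2B S 1 := by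
    rw [zero_add, pow2B_one hS]
    exact one_lt_two'
  obtain ⟨w, hw, hc⟩ := exists_canonSeqC hIk (D := fun w p _ => Q w p) hD hQc.isCausal ht
    (by simpa using hL)
  refine ⟨w, by simpa using hw, fun p hp => (isCanonAtC_bit_iff hS w p).1 (hc p hp)⟩

/-- **Uniqueness of answer codes** (Buss 1990, Thm. 8). [cite: BussContempMath1990, Thm. 8] -/
theorem IsAnswerCode.unique {Q : M → M → Prop} {S L w w' : M} (hQc : IsCausal₁ Q S)
    (hL : L ≤ mLen S) (hw : IsAnswerCode Q S L w) (hw' : IsAnswerCode Q S L w') : w = w' := by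
  rcases eq_or_ne L 0 with hL0 | hL0
  · subst hL0
    have h1 : pow2B S 0 = 1 := pow2B_zero S
    have a := hw.1; have a' := hw'.1
    rw [h1] at a a'
    rw [eq_zero_of_lt_one a, eq_zero_of_lt_one a']
  have hS : 1 ≤ mLen S := le_trans ((one_le_iff_ne_zero' L).2 hL0) hL
  refine canonSeqC_unique (D := fun w p _ => Q w p) (t := 0) hQc.isCausal (by simpa using hL)
    (by simpa using hw.1) (by simpa using hw'.1) (fun p hp => (isCanonAtC_bit_iff hS w p).2
      (hw.2 p hp)) (fun p hp => (isCanonAtC_bit_iff hS w' p).2 (hw'.2 p hp))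

open scoped Classical in
/-- `answerCode Q S L`: the answer code of length `L` of the query family `Q` (if it exists;
`0` otherwise) (Buss 1990, Thm. 8). [cite: BussContempMath1990, Thm. 8] -/
noncomputable def answerCode (Q : M → M → Prop) (S L : M) : M :=
  if h : ∃ w, IsAnswerCode Q S L w then Classical.choose h else 0

/-- The chosen answer code is an answer code, if there is one. [folklore] -/
theorem isAnswerCode_answerCode {Q : M → M → Prop} {S L : M} (h : ∃ w, IsAnswerCode Q S L w) :
    IsAnswerCode Q S L (answerCode Q S L) := by
  rw [answerCode, dif_pos h]
  exact Classical.choose_spec h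

/-- Any answer code is the chosen one. [folklore] -/
theorem IsAnswerCode.eq_answerCode {Q : M → M → Prop} {S L w : M} (hQc : IsCausal₁ Q S)
    (hL : L ≤ mLen S) (hw : IsAnswerCode Q S L w) : w = answerCode Q S L :=
  hw.unique hQc hL (isAnswerCode_answerCode ⟨w, hw⟩)

namespace IsAnswerCode

variable {Q : M → M → Prop} {S L w : M}

/-- An answer code is `< 2ᴸ`. [folklore] -/
theorem lt (h : IsAnswerCode Q S L w) : w < pow2B S L := h.1

/-- The answer bits. [folklore] -/
theorem bit_iff (h : IsAnswerCode Q S L w) {p : M} (hp : p < L) : seqEl S 1 w p = 1 ↔ Q w p :=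
  h.2 p hp

/-- A positive answer gives the bit `1`. [folklore] -/
theorem bit_eq_one (h : IsAnswerCode Q S L w) {p : M} (hp : p < L) (hQ : Q w p) :
    seqEl S 1 w p = 1 := (h.2 p hp).2 hQ

/-- A negative answer gives the bit `0` (`|S| ≥ 1`). [folklore] -/
theorem bit_eq_zero (h : IsAnswerCode Q S L w) (hS : 1 ≤ mLen S) {p : M} (hp : p < L)
    (hQ : ¬Q w p) : seqEl S 1 w p = 0 := by
  rcases seqEl_one_eq_zero_or_eq_one hS w p with h0 | h1
  · exact h0
  · exact (hQ ((h.2 p hp).1 h1)).elim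

/-- The answer code of length `0` is `0`. [folklore] -/
theorem eq_zero (h : IsAnswerCode Q S 0 w) : w = 0 := by
  have a := h.1
  rw [pow2B_zero] at a
  exact eq_zero_of_lt_one a

/-- Answer codes do not depend on the length bound `S` (as long as `L ≤ |S|`), the query
family being the same predicate. [folklore] -/
theorem congr_S {S' : M} (h : IsAnswerCode Q S L w) (hL : L ≤ mLen S) (hL' : L ≤ mLen S') :
    IsAnswerCode Q S' L w := by
  refine ⟨by rw [← pow2B_congr hL hL']; exact h.1, fun p hp => ?_⟩
  have hp1 : p + 1 ≤ L := (add_one_le_iff' p L).2 hp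
  rw [← seqEl_one_congr (hp1.trans hL) (hp1.trans hL')]
  exact h.2 p hp

end IsAnswerCode

/-- `0` is the answer code of length `0`. [folklore] -/
theorem isAnswerCode_zero_length (Q : M → M → Prop) (S : M) : IsAnswerCode Q S 0 0 :=
  ⟨by rw [pow2B_zero]; exact zero_lt_one, fun p hp => (not_lt_bot hp).elim⟩

end AnswerCodes

/-! ## Auxiliary definability lemmas -/

section Aux

variable {i m : ℕ}

omit hI in
/-- Extending two comparable tuples by comparable last entries. [folklore] -/
theorem snoc_le_snoc {xs ys : Fin m → M} (h : ∀ j, xs j ≤ ys j) {a b : M} (hab : a ≤ b) :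
    ∀ j, (Fin.snoc xs a : Fin (m + 1) → M) j ≤ (Fin.snoc ys b : Fin (m + 1) → M) j := by
  intro j
  cases j using Fin.lastCases with
  | last => simpa using hab
  | cast j => simpa using h j

/-- A `Σᵇ`-definable function is bounded by a term *function of its bound*: from
`F x̄ ≤ B x̄` and monotonicity of terms. Version of `IsSigmabFn.snocFn` computing the bound of
the composite `F(x̄, G x̄)` automatically (terms are monotone in models of `T₂¹`). [folklore] -/
theorem _root_.Literature.Computability.MetaComplexity.IsSigmabFn.snocFn'
    {F : (Fin (m + 1) → M) → M} (hF : IsSigmabFn (i + 1) F) {G : (Fin m → M) → M}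
    (hG : IsSigmabFn (i + 1) G) : IsSigmabFn (i + 1) fun xs : Fin m → M => F (Fin.snoc xs (G xs)) := by
  refine hF.snocFn hG ?_
  obtain ⟨BF, hBF, hFB⟩ := hF.bounded
  obtain ⟨BG, hBG, hGB⟩ := hG.bounded
  refine ⟨fun xs => BF (Fin.snoc xs (BG xs)), hBF.snoc hBG, fun xs => ?_⟩
  change F (Fin.snoc xs (G xs)) ≤ BF (Fin.snoc xs (BG xs))
  exact ((mLe_iff _ _).1 (hFB _)).trans
    (hBF.monotone (snoc_le_snoc (fun _ => le_rfl) ((mLe_iff _ _).1 (hGB xs))))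

omit hI in
/-- The bound of a `Σᵇ`-definable function, as a term function. [folklore] -/
theorem _root_.Literature.Computability.MetaComplexity.IsSigmabFn.exists_bound
    {F : (Fin m → M) → M} (hF : IsSigmabFn i F) :
    ∃ B : (Fin m → M) → M, IsTermFn B ∧ ∀ xs, F xs ≤ B xs := by
  obtain ⟨B, hB, hFB⟩ := hF.bounded
  exact ⟨B, hB, fun xs => (mLe_iff _ _).1 (hFB xs)⟩

/-- `IsSigmabFn.comp₁Fn` with the bound of the composite computed automatically (terms are
monotone in models of `T₂¹`). [folklore] -/
theorem _root_.Literature.Computability.MetaComplexity.IsSigmabFn.comp₁Fn' {f : M → M}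
    (hf : IsSigmabFn (i + 1) fun v : Fin 1 → M => f (v 0)) {G : (Fin m → M) → M}
    (hG : IsSigmabFn (i + 1) G) : IsSigmabFn (i + 1) fun xs => f (G xs) := by
  refine hf.comp₁Fn hG ?_
  obtain ⟨Bf, hBf, hfB⟩ := hf.exists_bound
  obtain ⟨BG, hBG, hGB⟩ := hG.exists_bound
  have hBf' : IsTermFn fun v : Fin 1 → M => Bf ![v 0] :=
    hBf.of_eq fun v => by congr 1; ext j; fin_cases j; rfl
  refine ⟨fun xs => Bf ![BG xs], hBf'.comp₁ (f := fun a => Bf ![a]) hBG, fun xs => ?_⟩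
  rw [mLe_iff]
  calc f (G xs) ≤ Bf ![G xs] := by simpa using hfB ![G xs]
    _ ≤ Bf ![BG xs] := hBf.monotone fun j => by fin_cases j; simpa using hGB xs

/-- `IsSigmabFn.comp₂FnFn` with the bound of the composite computed automatically. [folklore] -/
theorem _root_.Literature.Computability.MetaComplexity.IsSigmabFn.comp₂FnFn' {f : M → M → M}
    (hf : IsSigmabFn (i + 1) fun w : Fin 2 → M => f (w 0) (w 1)) {G H : (Fin m → M) → M}
    (hG : IsSigmabFn (i + 1) G) (hH : IsSigmabFn (i + 1) H) :
    IsSigmabFn (i + 1) fun xs => f (G xs) (H xs) := by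
  refine hf.comp₂FnFn hG hH ?_
  obtain ⟨Bf, hBf, hfB⟩ := hf.exists_bound
  obtain ⟨BG, hBG, hGB⟩ := hG.exists_bound
  obtain ⟨BH, hBH, hHB⟩ := hH.exists_bound
  have hBf' : IsTermFn fun w : Fin 2 → M => Bf ![w 0, w 1] :=
    hBf.of_eq fun w => by congr 1; ext j; fin_cases j <;> rfl
  refine ⟨fun xs => Bf ![BG xs, BH xs], hBf'.comp₂ (f := fun a b => Bf ![a, b]) hBG hBH,
    fun xs => ?_⟩
  rw [mLe_iff]
  calc f (G xs) (H xs) ≤ Bf ![G xs, H xs] := by simpa using hfB ![G xs, H xs]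
    _ ≤ Bf ![BG xs, BH xs] := hBf.monotone fun j => by
        fin_cases j
        · simpa using hGB xs
        · simpa using hHB xs

omit [Language.boundedArith.Structure M] hB hI in
/-- `Fin.init (Fin.init u)` as a composition with an index map. [folklore] -/
theorem init_init_eq_comp (u : Fin (m + 2) → M) :
    Fin.init (Fin.init u) = u ∘ fun j : Fin m => j.castSucc.castSucc := rfl

omit [Language.boundedArith.Structure M] hB hI in
/-- `Fin.init u` as a composition with an index map. [folklore] -/
theorem init_eq_comp (u : Fin (m + 1) → M) : Fin.init u = u ∘ Fin.castSucc := rfl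

end Aux

/-! ## Query presentations -/

section Presentations

variable {k n : ℕ}

/-- Uniform `Σᵇₖ₊₁`-definability (with parameters) of a query family `Q x̄ w p` in all its
arguments `(x̄, w, p)`. [folklore] -/
def IsSigmabQuery (k : ℕ) (Q : (Fin n → M) → M → M → Prop) : Prop :=
  IsSigmabDef (k + 1) fun u : Fin (n + 2) → M =>
    Q (Fin.init (Fin.init u)) (u (Fin.last n).castSucc) (u (Fin.last (n + 1)))

/-- Uniform `Σᵇₖ₊₁`-definability of an output function `OUT x̄ w` in `(x̄, w)`. [folklore] -/
def IsSigmabOut (k : ℕ) (OUT : (Fin n → M) → M → M) : Prop :=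
  IsSigmabFn (k + 1) fun u : Fin (n + 1) → M => OUT (Fin.init u) (u (Fin.last n))

omit hB hI in
/-- The tuple `(x̄, a, b)` as a function of `(a, b)`, coordinatewise a term function. [folklore] -/
theorem isTermFn_snoc_snoc_apply (x : Fin n → M) (j : Fin (n + 2)) :
    IsTermFn fun v : Fin 2 → M => (Fin.snoc (Fin.snoc x (v 0) : Fin (n + 1) → M) (v 1) :
      Fin (n + 2) → M) j := by
  cases j using Fin.lastCases with
  | last => simpa using IsTermFn.proj (1 : Fin 2)
  | cast j =>
    cases j using Fin.lastCases with
    | last => simpa using IsTermFn.proj (0 : Fin 2)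
    | cast j => simpa using IsTermFn.const (x j)

omit hB hI in
/-- The tuple `(x̄, a)` as a function of `a`, coordinatewise a term function. [folklore] -/
theorem isTermFn_snoc_apply (x : Fin n → M) (j : Fin (n + 1)) :
    IsTermFn fun v : Fin 1 → M => (Fin.snoc x (v 0) : Fin (n + 1) → M) j := by
  cases j using Fin.lastCases with
  | last => simpa using IsTermFn.proj (0 : Fin 1)
  | cast j => simpa using IsTermFn.const (x j)

omit hB hI in
/-- A uniformly definable query family is definable in `(w, p)` at fixed arguments `x̄`
(as parameters). [folklore] -/
theorem IsSigmabQuery.at {Q : (Fin n → M) → M → M → Prop} (hQ : IsSigmabQuery k Q)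
    (x : Fin n → M) : IsSigmabDef (k + 1) fun v : Fin 2 → M => Q x (v 0) (v 1) := by
  refine (IsSigmabDef.substAll hQ (isTermFn_snoc_snoc_apply x)).of_iff fun v => ?_
  simp

omit hB hI in
/-- A uniformly definable output function is definable in `w` at fixed arguments `x̄`.
[folklore] -/
theorem IsSigmabOut.at {OUT : (Fin n → M) → M → M} (hO : IsSigmabOut k OUT) (x : Fin n → M) :
    IsSigmabFn (k + 1) fun v : Fin 1 → M => OUT x (v 0) := by
  refine (IsSigmabFn.substAll hO (isTermFn_snoc_apply x)).of_eq fun v => ?_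
  simp

/-! ### Closure properties of uniformly definable output functions and query families -/

omit hI in
/-- A term function of `(x̄, w)` is a uniformly definable output function. [folklore] -/
theorem IsSigmabOut.of_isTermFn {O : (Fin n → M) → M → M}
    (hO : IsTermFn fun u : Fin (n + 1) → M => O (Fin.init u) (u (Fin.last n))) :
    IsSigmabOut k O :=
  isSigmabFn_of_isTermFn hO _

omit hB hI in
/-- A term function of the arguments alone, as a function of `(x̄, w)`. [folklore] -/
theorem isTermFn_init {T : (Fin n → M) → M} (hT : IsTermFn T) :
    IsTermFn fun u : Fin (n + 1) → M => T (Fin.init u) :=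
  (hT.comp Fin.castSucc).of_eq fun _ => rfl

omit hB hI in
/-- A term function of the arguments alone, as a function of `(x̄, w, p)`. [folklore] -/
theorem isTermFn_init_init {T : (Fin n → M) → M} (hT : IsTermFn T) :
    IsTermFn fun u : Fin (n + 2) → M => T (Fin.init (Fin.init u)) :=
  ((hT.comp Fin.castSucc).comp Fin.castSucc).of_eq fun _ => rfl

omit hI in
/-- The code itself is a uniformly definable output function. [folklore] -/
theorem IsSigmabOut.code : IsSigmabOut k fun (_ : Fin n → M) (w : M) => w :=
  IsSigmabOut.of_isTermFn (IsTermFn.proj (Fin.last n))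

omit hI in
/-- A term function of the arguments is a uniformly definable output function. [folklore] -/
theorem IsSigmabOut.args {T : (Fin n → M) → M} (hT : IsTermFn T) :
    IsSigmabOut k fun (x : Fin n → M) (_ : M) => T x :=
  IsSigmabOut.of_isTermFn (isTermFn_init hT)

/-- Uniformly definable output functions are closed under binary `Σᵇₖ₊₁`-definable operations.
[folklore] -/
theorem IsSigmabOut.map₂ {f : M → M → M}
    (hf : IsSigmabFn (k + 1) fun w : Fin 2 → M => f (w 0) (w 1)) {O₁ O₂ : (Fin n → M) → M → M}
    (h₁ : IsSigmabOut k O₁) (h₂ : IsSigmabOut k O₂) : IsSigmabOut k fun x w => f (O₁ x w) (O₂ x w) :=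
  hf.comp₂FnFn' h₁ h₂

/-- Uniformly definable output functions are closed under unary `Σᵇₖ₊₁`-definable operations.
[folklore] -/
theorem IsSigmabOut.map₁ {f : M → M} (hf : IsSigmabFn (k + 1) fun v : Fin 1 → M => f (v 0))
    {O : (Fin n → M) → M → M} (h : IsSigmabOut k O) : IsSigmabOut k fun x w => f (O x w) :=
  hf.comp₁Fn' h

/-- `w mod 2^{B x̄}` (exponents under `|A x̄|`) is a uniformly definable output function, for
term functions `A`, `B` … more generally for uniformly definable `A`, `B`, `W`. [folklore] -/
theorem IsSigmabOut.modPow2B {A B W : (Fin n → M) → M → M} (hA : IsSigmabOut k A)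
    (hB : IsSigmabOut k B) (hW : IsSigmabOut k W) :
    IsSigmabOut k fun x w => W x w % pow2B (A x w) (B x w) :=
  (isSigmabFn_mod' k).comp₂FnFn' hW ((isSigmabFn_pow2B' k).comp₂FnFn' hA hB)

/-- `⌊W / 2^{B}⌋` (exponents under `|A|`) is a uniformly definable output function. [folklore] -/
theorem IsSigmabOut.divPow2B {A B W : (Fin n → M) → M → M} (hA : IsSigmabOut k A)
    (hB : IsSigmabOut k B) (hW : IsSigmabOut k W) :
    IsSigmabOut k fun x w => W x w / pow2B (A x w) (B x w) :=
  ((isSigmabFn_div 1).mono (Nat.le_add_left 1 k)).comp₂FnFn' hW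
    ((isSigmabFn_pow2B' k).comp₂FnFn' hA hB)

omit hB hI in
/-- Lifting an output function to the query context `(x̄, w, p)` (ignoring `p`). [folklore] -/
theorem IsSigmabOut.lift {O : (Fin n → M) → M → M} (hO : IsSigmabOut k O) :
    IsSigmabFn (k + 1) fun u : Fin (n + 2) → M =>
      O (Fin.init (Fin.init u)) (u (Fin.last n).castSucc) :=
  (IsSigmabFn.comp hO Fin.castSucc).of_eq fun _ => rfl

omit hB hI in
/-- **Substituting output functions for the code and a definable function for the position** in
a uniformly definable query family: `(x̄, w, p) ↦ Q x̄ (C x̄ w) (D x̄ w p)`. [folklore] -/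
theorem IsSigmabQuery.substCodePos {Q : (Fin n → M) → M → M → Prop} (hQ : IsSigmabQuery k Q)
    {C : (Fin n → M) → M → M} (hC : IsSigmabOut k C) {D : (Fin n → M) → M → M → M}
    (hD : IsSigmabFn (k + 1) fun u : Fin (n + 2) → M =>
      D (Fin.init (Fin.init u)) (u (Fin.last n).castSucc) (u (Fin.last (n + 1)))) :
    IsSigmabQuery k fun x w p => Q x (C x w) (D x w p) := by
  -- context `(x̄, w, p, c, d)` : `Fin (n + 4)`;  `R u := Q x̄ c d`
  let e : Fin (n + 2) → Fin (n + 4) :=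
    Fin.snoc (α := fun _ => Fin (n + 4))
      (Fin.snoc (α := fun _ => Fin (n + 4)) (fun j => j.castSucc.castSucc.castSucc.castSucc)
        (Fin.last (n + 2)).castSucc) (Fin.last (n + 3))
  have hR : IsSigmabDef (k + 1) fun U : Fin (n + 4) → M =>
      Q (Fin.init (Fin.init (Fin.init (Fin.init U)))) (U (Fin.last (n + 2)).castSucc)
        (U (Fin.last (n + 3))) := by
    refine (IsSigmabDef.comp hQ e).of_iff fun U => ?_
    have e1 : Fin.init (Fin.init (U ∘ e)) = Fin.init (Fin.init (Fin.init (Fin.init U))) := by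
      funext j; simp [e, Fin.init]
    have e2 : (U ∘ e) (Fin.last n).castSucc = U (Fin.last (n + 2)).castSucc := by simp [e]
    have e3 : (U ∘ e) (Fin.last (n + 1)) = U (Fin.last (n + 3)) := by simp [e]
    simp only [e1, e2, e3]
  -- substitute `d := D x̄ w p` (a function of the first `n + 3` coordinates, ignoring `c`)
  have hD' : IsSigmabFn (k + 1) fun V : Fin (n + 3) → M =>
      D (Fin.init (Fin.init (Fin.init V))) (V (Fin.last n).castSucc.castSucc)
        (V (Fin.last (n + 1)).castSucc) :=
    (IsSigmabFn.comp hD Fin.castSucc).of_eq fun _ => rfl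
  have h1 := hR.snocFn hD'
  -- substitute `c := C x̄ w` (a function of the first `n + 2` coordinates, ignoring `p`)
  have hC' : IsSigmabFn (k + 1) fun u : Fin (n + 2) → M =>
      C (Fin.init (Fin.init u)) (u (Fin.last n).castSucc) := hC.lift
  have h2 := h1.snocFn hC'
  refine h2.of_iff fun u => ?_
  simp [Fin.init_snoc, Fin.snoc_castSucc, Fin.snoc_last]

omit hB hI in
/-- **Substituting an output function for the last argument and one for the code** in a
uniformly definable query family of arity `n + 1`:
`(x̄, w, p) ↦ Q (x̄, Y x̄ w) (C x̄ w) p`. [folklore] -/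
theorem IsSigmabQuery.snocArg {Q : (Fin (n + 1) → M) → M → M → Prop} (hQ : IsSigmabQuery k Q)
    {Y C : (Fin n → M) → M → M} (hY : IsSigmabOut k Y) (hC : IsSigmabOut k C) :
    IsSigmabQuery k fun x w p => Q (Fin.snoc x (Y x w)) (C x w) p := by
  -- context `(x̄, w, p, y, c)` : `Fin (n + 4)`;  `R U := Q (x̄, y) c p`
  let e : Fin (n + 3) → Fin (n + 4) :=
    Fin.snoc (α := fun _ => Fin (n + 4))
      (Fin.snoc (α := fun _ => Fin (n + 4))
        (Fin.snoc (α := fun _ => Fin (n + 4)) (fun j => j.castSucc.castSucc.castSucc.castSucc)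
          (Fin.last (n + 2)).castSucc)
        (Fin.last (n + 3)))
      (Fin.last (n + 1)).castSucc.castSucc
  have hR : IsSigmabDef (k + 1) fun U : Fin (n + 4) → M =>
      Q (Fin.snoc (Fin.init (Fin.init (Fin.init (Fin.init U)))) (U (Fin.last (n + 2)).castSucc))
        (U (Fin.last (n + 3))) (U (Fin.last (n + 1)).castSucc.castSucc) := by
    refine (IsSigmabDef.comp hQ e).of_iff fun U => ?_
    have e1 : Fin.init (Fin.init (U ∘ e)) =
        Fin.snoc (Fin.init (Fin.init (Fin.init (Fin.init U)))) (U (Fin.last (n + 2)).castSucc) := by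
      funext j
      cases j using Fin.lastCases with
      | last => simp [e, Fin.init]
      | cast j => simp [e, Fin.init]
    have e2 : (U ∘ e) (Fin.last (n + 1)).castSucc = U (Fin.last (n + 3)) := by simp [e]
    have e3 : (U ∘ e) (Fin.last (n + 2)) = U (Fin.last (n + 1)).castSucc.castSucc := by simp [e]
    rw [IsSigmabQuery] at hQ
    simp only [e1, e2, e3]
  have hC' : IsSigmabFn (k + 1) fun V : Fin (n + 3) → M =>
      C (Fin.init (Fin.init (Fin.init V))) (V (Fin.last n).castSucc.castSucc) :=
    ((IsSigmabFn.comp hC Fin.castSucc).comp Fin.castSucc).of_eq fun _ => rfl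
  have h1 := hR.snocFn hC'
  have h2 := h1.snocFn hY.lift
  refine h2.of_iff fun u => ?_
  simp [Fin.init_snoc, Fin.snoc_castSucc, Fin.snoc_last]

/-- **Substituting an output function for the last argument and one for the code** in a
uniformly definable output function of arity `n + 1`: `(x̄, w) ↦ OUT (x̄, Y x̄ w) (C x̄ w)`.
[folklore] -/
theorem IsSigmabOut.snocArg {O : (Fin (n + 1) → M) → M → M} (hO : IsSigmabOut k O)
    {Y C : (Fin n → M) → M → M} (hY : IsSigmabOut k Y) (hC : IsSigmabOut k C) :
    IsSigmabOut k fun x w => O (Fin.snoc x (Y x w)) (C x w) := by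
  -- context `(x̄, w, y, c)` : `Fin (n + 3)`;  `F V := O (x̄, y) c`
  let e : Fin (n + 2) → Fin (n + 3) :=
    Fin.snoc (α := fun _ => Fin (n + 3))
      (Fin.snoc (α := fun _ => Fin (n + 3)) (fun j => j.castSucc.castSucc.castSucc)
        (Fin.last (n + 1)).castSucc) (Fin.last (n + 2))
  have hF : IsSigmabFn (k + 1) fun V : Fin (n + 3) → M =>
      O (Fin.snoc (Fin.init (Fin.init (Fin.init V))) (V (Fin.last (n + 1)).castSucc))
        (V (Fin.last (n + 2))) := by
    refine (IsSigmabFn.comp hO e).of_eq fun V => ?_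
    have e1 : Fin.init (V ∘ e) =
        Fin.snoc (Fin.init (Fin.init (Fin.init V))) (V (Fin.last (n + 1)).castSucc) := by
      funext j
      cases j using Fin.lastCases with
      | last => simp [e, Fin.init]
      | cast j => simp [e, Fin.init]
    have e2 : (V ∘ e) (Fin.last (n + 1)) = V (Fin.last (n + 2)) := by simp [e]
    simp only [e1, e2]
  have h1 := hF.snocFn' hC.lift
  have h2 := h1.snocFn' hY
  refine h2.of_eq fun u => ?_
  simp [Fin.init_snoc, Fin.snoc_castSucc, Fin.snoc_last]

/-- **Substituting an output function for the code** of a uniformly definable output function: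
`(x̄, w) ↦ O x̄ (C x̄ w)`. [folklore] -/
theorem IsSigmabOut.substCode {O : (Fin n → M) → M → M} (hO : IsSigmabOut k O)
    {C : (Fin n → M) → M → M} (hC : IsSigmabOut k C) : IsSigmabOut k fun x w => O x (C x w) := by
  -- context `(x̄, w, c)` : `Fin (n + 2)`;  `F u := O x̄ c`
  let e : Fin (n + 1) → Fin (n + 2) :=
    Fin.snoc (α := fun _ => Fin (n + 2)) (fun j => j.castSucc.castSucc) (Fin.last (n + 1))
  have hF : IsSigmabFn (k + 1) fun u : Fin (n + 2) → M =>
      O (Fin.init (Fin.init u)) (u (Fin.last (n + 1))) := by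
    refine (IsSigmabFn.comp hO e).of_eq fun u => ?_
    have e1 : Fin.init (u ∘ e) = Fin.init (Fin.init u) := by
      funext j; simp [e, Fin.init]
    have e2 : (u ∘ e) (Fin.last n) = u (Fin.last (n + 1)) := by simp [e]
    simp only [e1, e2]
  refine (hF.snocFn' hC).of_eq fun u => ?_
  simp [Fin.init_snoc, Fin.snoc_last]

omit hB hI in
/-- Uniformly definable query families are closed under `∧`. [folklore] -/
theorem IsSigmabQuery.and {Q Q' : (Fin n → M) → M → M → Prop} (hQ : IsSigmabQuery k Q)
    (hQ' : IsSigmabQuery k Q') : IsSigmabQuery k fun x w p => Q x w p ∧ Q' x w p :=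
  IsSigmabDef.and hQ hQ'

omit hB hI in
/-- Uniformly definable query families are closed under `∨`. [folklore] -/
theorem IsSigmabQuery.or {Q Q' : (Fin n → M) → M → M → Prop} (hQ : IsSigmabQuery k Q)
    (hQ' : IsSigmabQuery k Q') : IsSigmabQuery k fun x w p => Q x w p ∨ Q' x w p :=
  IsSigmabDef.or hQ hQ'

omit hB hI in
/-- An open condition on `(x̄, w, p)` is a uniformly definable query family. [folklore] -/
theorem IsSigmabQuery.of_isQFDef {Q : (Fin n → M) → M → M → Prop}
    (hQ : IsQFDef fun u : Fin (n + 2) → M =>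
      Q (Fin.init (Fin.init u)) (u (Fin.last n).castSucc) (u (Fin.last (n + 1)))) :
    IsSigmabQuery k Q :=
  hQ.isSigmabDef _

omit hI in
/-- A comparison `p < F x̄ w` with a `Σᵇₖ₊₁`-definable `F` is a uniformly definable query family
(it is `Δᵇₖ₊₁`). [folklore] -/
theorem IsSigmabQuery.pos_lt {F : (Fin n → M) → M → M} (hF : IsSigmabOut k F) :
    IsSigmabQuery k fun x w p => p < F x w := by
  have h := hF.lift.isDeltabDef_le
    (isSigmabFn_of_isTermFn (IsTermFn.proj (Fin.last (n + 1))) (k + 1))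
  refine (h.not.1).of_iff fun u => ?_
  simp [mLe_iff, not_le]

variable (M) in
/-- **Binary query presentation** of an `n`-ary function (Buss 1990, §3, Definition of
`Qᵢ`-definability, semantic form with `P^{Σᵖ}`-style sequential yes/no queries): term functions
`L` (number of queries) and `S` (length bound, `L ≤ |S|`, `1 ≤ |S|`), a `Σᵇₖ₊₁`-definable
causal query family `Q x̄ w p` and a `Σᵇₖ₊₁`-definable output function `OUT x̄ w`.  The presented
function is `x̄ ↦ OUT x̄ (answerCode (Q x̄) (S x̄) (L x̄))` (`QPres.eval`).
[cite: BussContempMath1990, §3, Definition of `Qᵢ`-definability] -/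
structure QPres (k n : ℕ) where
  /-- The number of queries. -/
  L : (Fin n → M) → M
  /-- The length bound under which bits are taken. -/
  S : (Fin n → M) → M
  /-- The query family: `Q x̄ w p` is the `p`-th query, about the answer code `w`. -/
  Q : (Fin n → M) → M → M → Prop
  /-- The output function of the arguments and the answer code. -/
  OUT : (Fin n → M) → M → M
  /-- `L` is a term function. -/
  isTermFn_L : IsTermFn L
  /-- `S` is a term function. -/
  isTermFn_S : IsTermFn S
  /-- `L ≤ |S|`. -/
  L_le : ∀ x, L x ≤ mLen (S x)
  /-- `1 ≤ |S|`. -/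
  one_le : ∀ x, 1 ≤ mLen (S x)
  /-- `Q` is `Σᵇₖ₊₁`-definable uniformly. -/
  isSigmabQuery : IsSigmabQuery k Q
  /-- `Q x̄` is causal. -/
  isCausal : ∀ x, IsCausal₁ (Q x) (S x)
  /-- `OUT` is `Σᵇₖ₊₁`-definable uniformly. -/
  isSigmabOut : IsSigmabOut k OUT

namespace QPres

variable (P : QPres M k n)

/-- The answer code of the presentation at `x̄`. [folklore] -/
noncomputable def code (x : Fin n → M) : M := answerCode (P.Q x) (P.S x) (P.L x)

/-- The function presented: `OUT x̄ (code x̄)` (Buss 1990, §3: `f(x̄) = f*(w, x̄)`).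
[cite: BussContempMath1990, §3, Definition of `Qᵢ`-definability] -/
noncomputable def eval (x : Fin n → M) : M := P.OUT x (P.code x)

/-- In a model of `Σᵇₖ₊₁-IND` the answer code exists: `P.code x̄` is an answer code.
[cite: BussContempMath1990, Thm. 8] -/
theorem isAnswerCode_code (hIk : M ⊨ INDScheme (sigmabFormulas (k + 1))) (x : Fin n → M) :
    IsAnswerCode (P.Q x) (P.S x) (P.L x) (P.code x) :=
  isAnswerCode_answerCode (exists_isAnswerCode hIk (P.isSigmabQuery.at x) (P.isCausal x)
    (P.one_le x) (P.L_le x))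

/-- Any answer code for the queries of `P` at `x̄` is `P.code x̄`. [folklore] -/
theorem eq_code {x : Fin n → M} {w : M} (hw : IsAnswerCode (P.Q x) (P.S x) (P.L x) w) :
    w = P.code x :=
  hw.eq_answerCode (P.isCausal x) (P.L_le x)

/-- The value at `x̄`, computed from any answer code. [folklore] -/
theorem eval_eq_of_isAnswerCode {x : Fin n → M} {w : M}
    (hw : IsAnswerCode (P.Q x) (P.S x) (P.L x) w) : P.eval x = P.OUT x w := by
  rw [eval, ← P.eq_code hw]

/-- The answer code is below `2ᴸ`. [folklore] -/
theorem code_lt (hIk : M ⊨ INDScheme (sigmabFormulas (k + 1))) (x : Fin n → M) :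
    P.code x < pow2B (P.S x) (P.L x) := (P.isAnswerCode_code hIk x).lt

/-- The answer code is `≤ 2·S + 1` (a term bound; also when no answer code exists, the junk
value being `0`). [folklore] -/
theorem code_le (x : Fin n → M) : P.code x ≤ 2 * P.S x + 1 := by
  rw [code, answerCode]
  split_ifs with h
  · exact (Classical.choose_spec h).lt.le.trans (pow2B_le _ _)
  · exact bot_le

/-- The chosen bounding term of the output function. [folklore] -/
noncomputable def outBound : (Fin (n + 1) → M) → M := Classical.choose P.isSigmabOut.bounded

/-- `outBound` is a term function. [folklore] -/
theorem isTermFn_outBound : IsTermFn P.outBound := (Classical.choose_spec P.isSigmabOut.bounded).1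

/-- `OUT x̄ w ≤ outBound (x̄, w)`. [folklore] -/
theorem out_le_outBound (x : Fin n → M) (w : M) : P.OUT x w ≤ P.outBound (Fin.snoc x w) := by
  have h := (Classical.choose_spec P.isSigmabOut.bounded).2 (Fin.snoc x w)
  simpa [outBound] using h

/-- **The bounding term of a presented function**: `bnd x̄ = outBound (x̄, 2·S x̄ + 1)`. [folklore] -/
noncomputable def bnd (x : Fin n → M) : M := P.outBound (Fin.snoc x (2 * P.S x + 1))

/-- `bnd` is a term function. [folklore] -/
theorem isTermFn_bnd : IsTermFn P.bnd :=
  P.isTermFn_outBound.snoc (isTermFn_add_one (isTermFn_two_mul P.isTermFn_S))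

/-- `OUT x̄ w ≤ bnd x̄` for every code `w ≤ 2·S x̄ + 1`. [folklore] -/
theorem out_le_bnd (x : Fin n → M) {w : M} (hw : w ≤ 2 * P.S x + 1) : P.OUT x w ≤ P.bnd x :=
  (P.out_le_outBound x w).trans
    (P.isTermFn_outBound.monotone (snoc_le_snoc (fun _ => le_rfl) hw))

/-- **A presented function is bounded by its bounding term**: `eval x̄ ≤ bnd x̄`. [folklore] -/
theorem eval_le_bnd (x : Fin n → M) : P.eval x ≤ P.bnd x := P.out_le_bnd x (P.code_le x)

/-- A presented function is bounded by a term. [folklore] -/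
theorem exists_bound : ∃ B : (Fin n → M) → M, IsTermFn B ∧ ∀ x, P.eval x ≤ B x :=
  ⟨P.bnd, P.isTermFn_bnd, P.eval_le_bnd⟩

end QPres

/-- `IsQFn k F`: the function `F : Mⁿ → M` is **query-presentable at level `k + 1`** — it has a
binary query presentation with `Σᵇₖ₊₁`-definable queries and output (Buss 1990, §3:
`Qₖ₊₁`-definable, semantically). [cite: BussContempMath1990, §3, Definition of `Qᵢ`-definability] -/
def IsQFn (k : ℕ) (F : (Fin n → M) → M) : Prop :=
  ∃ P : QPres M k n, ∀ x, F x = P.eval x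

/-- Transfer of `IsQFn` along an extensional equality. [folklore] -/
theorem IsQFn.of_eq {F G : (Fin n → M) → M} (hF : IsQFn k F) (h : ∀ x, F x = G x) : IsQFn k G := by
  obtain ⟨P, hP⟩ := hF
  exact ⟨P, fun x => (h x).symm.trans (hP x)⟩

/-- A query-presentable function is bounded by a term. [folklore] -/
theorem IsQFn.isBoundedFn {F : (Fin n → M) → M} (hF : IsQFn k F) : IsBoundedFn F := by
  obtain ⟨P, hP⟩ := hF
  exact ⟨P.bnd, P.isTermFn_bnd, fun x => by simpa [hP x] using P.eval_le_bnd x⟩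

/-! ### `Σᵇ`-definable functions (no queries) -/

/-- The presentation without queries of a `Σᵇₖ₊₁`-definable function (Buss 1990, §3: every
`Σᵇ`-defined function is `Qᵢ`-defined). [cite: BussContempMath1990, §3] -/
noncomputable def QPres.ofSigmabFn (F : (Fin n → M) → M) (hF : IsSigmabFn (k + 1) F) :
    QPres M k n where
  L := fun _ => 0
  S := fun _ => 1
  Q := fun _ _ _ => False
  OUT := fun x _ => F x
  isTermFn_L := isTermFn_zero
  isTermFn_S := isTermFn_one
  L_le := fun _ => bot_le
  one_le := fun _ => by simp
  isSigmabQuery := IsQFDef.bot.isSigmabDef _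
  isCausal := fun _ _ _ _ _ => Iff.rfl
  isSigmabOut := (hF.comp Fin.castSucc).of_eq fun _ => rfl

/-- **`Σᵇₖ₊₁`-definable functions are query-presentable** (Buss 1990, §3).
[cite: BussContempMath1990, §3] -/
theorem _root_.Literature.Computability.MetaComplexity.IsSigmabFn.isQFn {F : (Fin n → M) → M}
    (hF : IsSigmabFn (k + 1) F) : IsQFn k F :=
  ⟨QPres.ofSigmabFn F hF, fun _ => rfl⟩

/-- Term functions are query-presentable. [folklore] -/
theorem _root_.Literature.Computability.MetaComplexity.IsTermFn.isQFn {F : (Fin n → M) → M}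
    (hF : IsTermFn F) : IsQFn k F :=
  (isSigmabFn_of_isTermFn hF (k + 1)).isQFn

/-! ### Post-composition with a `Σᵇ`-definable function -/

/-- Post-composing a presentation with a `Σᵇₖ₊₁`-definable function `G(x̄, y)`: same queries,
output `G(x̄, OUT x̄ w)` (Buss 1990, Thm. 11(a), the case of a `Σᵇ`-defined outer function).
[cite: BussContempMath1990, Thm. 11(a)] -/
noncomputable def QPres.postcomp (P : QPres M k n) (G : (Fin (n + 1) → M) → M)
    (hG : IsSigmabFn (k + 1) G) : QPres M k n where
  L := P.L
  S := P.S
  Q := P.Q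
  OUT := fun x w => G (Fin.snoc x (P.OUT x w))
  isTermFn_L := P.isTermFn_L
  isTermFn_S := P.isTermFn_S
  L_le := P.L_le
  one_le := P.one_le
  isSigmabQuery := P.isSigmabQuery
  isCausal := P.isCausal
  isSigmabOut := by
    let e : Fin (n + 1) → Fin (n + 2) :=
      Fin.snoc (α := fun _ => Fin (n + 2)) (fun j => j.castSucc.castSucc) (Fin.last (n + 1))
    have hG' : IsSigmabFn (k + 1) fun v : Fin (n + 2) → M => G (v ∘ e) := hG.comp e
    refine (hG'.snocFn' P.isSigmabOut).of_eq fun u => ?_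
    change G ((Fin.snoc u _ : Fin (n + 2) → M) ∘ e) = G (Fin.snoc (Fin.init u) _)
    congr 1
    funext j
    cases j using Fin.lastCases with
    | last => simp [e]
    | cast j => simp [e, Fin.init]

/-- Value of the post-composition. [folklore] -/
theorem QPres.eval_postcomp (P : QPres M k n) (G : (Fin (n + 1) → M) → M)
    (hG : IsSigmabFn (k + 1) G) (x : Fin n → M) :
    (P.postcomp G hG).eval x = G (Fin.snoc x (P.eval x)) := rfl

/-- **Post-composition**: `x̄ ↦ G(x̄, F x̄)` is query-presentable for `F` query-presentable and
`G` `Σᵇₖ₊₁`-definable (Buss 1990, Thm. 11(a)). [cite: BussContempMath1990, Thm. 11(a)] -/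
theorem IsQFn.postcomp {F : (Fin n → M) → M} (hF : IsQFn k F) {G : (Fin (n + 1) → M) → M}
    (hG : IsSigmabFn (k + 1) G) : IsQFn k fun x => G (Fin.snoc x (F x)) := by
  obtain ⟨P, hP⟩ := hF
  exact ⟨P.postcomp G hG, fun x => by rw [QPres.eval_postcomp, ← hP x]⟩

/-! ### Renaming of arguments -/

/-- Renaming the arguments of a presentation along `g : Fin n → Fin m`. [folklore] -/
noncomputable def QPres.relabel {m : ℕ} (P : QPres M k n) (g : Fin n → Fin m) : QPres M k m where
  L := fun x => P.L (x ∘ g)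
  S := fun x => P.S (x ∘ g)
  Q := fun x => P.Q (x ∘ g)
  OUT := fun x => P.OUT (x ∘ g)
  isTermFn_L := P.isTermFn_L.comp g
  isTermFn_S := P.isTermFn_S.comp g
  L_le := fun x => P.L_le _
  one_le := fun x => P.one_le _
  isSigmabQuery := by
    let g' : Fin (n + 2) → Fin (m + 2) :=
      Fin.snoc (α := fun _ => Fin (m + 2))
        (Fin.snoc (α := fun _ => Fin (m + 2)) (fun j => (g j).castSucc.castSucc)
          (Fin.last m).castSucc) (Fin.last (m + 1))
    refine (IsSigmabDef.comp P.isSigmabQuery g').of_iff fun u => ?_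
    have e1 : Fin.init (Fin.init (u ∘ g')) = Fin.init (Fin.init u) ∘ g := by
      funext j; simp [g', Fin.init]
    have e2 : (u ∘ g') (Fin.last n).castSucc = u (Fin.last m).castSucc := by simp [g']
    have e3 : (u ∘ g') (Fin.last (n + 1)) = u (Fin.last (m + 1)) := by simp [g']
    simp only [e1, e2, e3]
  isCausal := fun x => P.isCausal _
  isSigmabOut := by
    let g' : Fin (n + 1) → Fin (m + 1) :=
      Fin.snoc (α := fun _ => Fin (m + 1)) (fun j => (g j).castSucc) (Fin.last m)
    refine (IsSigmabFn.comp P.isSigmabOut g').of_eq fun u => ?_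
    have e1 : Fin.init (u ∘ g') = Fin.init u ∘ g := by
      funext j; simp [g', Fin.init]
    have e2 : (u ∘ g') (Fin.last n) = u (Fin.last m) := by simp [g']
    simp only [e1, e2]

/-- Value of the renamed presentation. [folklore] -/
theorem QPres.eval_relabel {m : ℕ} (P : QPres M k n) (g : Fin n → Fin m) (x : Fin m → M) :
    (P.relabel g).eval x = P.eval (x ∘ g) := rfl

/-- **Renaming of arguments** preserves query-presentability. [folklore] -/
theorem IsQFn.relabel {m : ℕ} {F : (Fin n → M) → M} (hF : IsQFn k F) (g : Fin n → Fin m) :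
    IsQFn k fun x : Fin m → M => F (x ∘ g) := by
  obtain ⟨P, hP⟩ := hF
  exact ⟨P.relabel g, fun x => by rw [QPres.eval_relabel, ← hP]⟩

/-! ### Characteristic functions (one query) -/

open scoped Classical in
/-- The characteristic function of a predicate: `1` on `P`, `0` off `P`. [folklore] -/
noncomputable def chiFn (P : (Fin n → M) → Prop) (x : Fin n → M) : M := if P x then 1 else 0

/-- `chiFn P x̄ ≤ 1`. [folklore] -/
theorem chiFn_le_one (P : (Fin n → M) → Prop) (x : Fin n → M) : chiFn P x ≤ 1 := by
  unfold chiFn; split_ifs <;> simp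

/-- `chiFn P x̄ = 1 ↔ P x̄`. [folklore] -/
theorem chiFn_eq_one_iff (P : (Fin n → M) → Prop) (x : Fin n → M) : chiFn P x = 1 ↔ P x := by
  unfold chiFn; split_ifs with h <;> simp [h]

/-- `chiFn P x̄ = 0 ↔ ¬P x̄`. [folklore] -/
theorem chiFn_eq_zero_iff (P : (Fin n → M) → Prop) (x : Fin n → M) : chiFn P x = 0 ↔ ¬P x := by
  unfold chiFn; split_ifs with h <;> simp [h]

/-- The characteristic function of the negation. [folklore] -/
theorem chiFn_not (P : (Fin n → M) → Prop) (x : Fin n → M) :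
    chiFn (fun x => ¬P x) x = 1 - chiFn P x := by
  unfold chiFn; split_ifs with h h' <;> simp_all

/-- Bit `0` of the code `1` is `1` (`|S| ≥ 1`). [folklore] -/
theorem seqEl_one_one_zero {S : M} (hS : 1 ≤ mLen S) : seqEl S 1 1 0 = 1 := by
  rw [seqEl, mul_one, digit, pow2B_zero, div_one', pow2B_one hS]
  exact mod_eq_self_of_lt one_lt_two'

/-- The one-query presentation of the characteristic function of a `Σᵇₖ₊₁`-definable
predicate: the single query is `P x̄` itself and the output is the answer code
(Buss 1990, §3 / Thm. 9: one oracle query). [cite: BussContempMath1990, Thm. 9] -/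
noncomputable def QPres.chi (P : (Fin n → M) → Prop) (hP : IsSigmabDef (k + 1) P) :
    QPres M k n where
  L := fun _ => 1
  S := fun _ => 1
  Q := fun x _ _ => P x
  OUT := fun _ w => w
  isTermFn_L := isTermFn_one
  isTermFn_S := isTermFn_one
  L_le := fun _ => by simp
  one_le := fun _ => by simp
  isSigmabQuery := (IsSigmabDef.comp hP fun j : Fin n => j.castSucc.castSucc).of_iff fun _ => Iff.rfl
  isCausal := fun _ _ _ _ _ => Iff.rfl
  isSigmabOut := isSigmabFn_of_isTermFn (IsTermFn.proj (Fin.last n)) _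

/-- The answer code of the one query `P x̄` is `chiFn P x̄`. [folklore] -/
theorem isAnswerCode_chi (P : (Fin n → M) → Prop) (x : Fin n → M) :
    IsAnswerCode (fun _ _ => P x) 1 1 (chiFn P x) := by
  have h1 : (1 : M) ≤ mLen 1 := by simp
  refine ⟨?_, fun p hp => ?_⟩
  · rw [pow2B_one h1, ← one_add_one_eq_two]
    exact (lt_add_one_iff' _ _).2 (chiFn_le_one P x)
  · have hp0 : p = 0 := eq_zero_of_lt_one hp
    subst hp0
    unfold chiFn
    split_ifs with h
    · simp [seqEl_one_one_zero h1, h]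
    · simp [h]

/-- Value of the one-query presentation. [folklore] -/
theorem QPres.eval_chi (P : (Fin n → M) → Prop) (hP : IsSigmabDef (k + 1) P) (x : Fin n → M) :
    (QPres.chi P hP).eval x = chiFn P x :=
  (QPres.chi P hP).eval_eq_of_isAnswerCode (isAnswerCode_chi P x)

/-- **Characteristic functions of `Σᵇₖ₊₁`-definable predicates are query-presentable**
(one query; Buss 1990, Thm. 9 / Cor. 10). [cite: BussContempMath1990, Thm. 9] -/
theorem isQFn_chiFn {P : (Fin n → M) → Prop} (hP : IsSigmabDef (k + 1) P) : IsQFn k (chiFn P) :=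
  ⟨QPres.chi P hP, fun x => (QPres.eval_chi P hP x).symm⟩

/-- **Characteristic functions of `Πᵇₖ₊₁`-definable predicates are query-presentable**
(query the negation; Buss 1990, Thm. 9 / Cor. 10). [cite: BussContempMath1990, Thm. 9] -/
theorem isQFn_chiFn_of_isPibDef {P : (Fin n → M) → Prop} (hP : IsPibDef (k + 1) P) :
    IsQFn k (chiFn P) := by
  have h := (isQFn_chiFn hP.not).postcomp (G := fun v : Fin (n + 1) → M => 1 - v (Fin.last n))
    (isSigmabFn_sub isTermFn_one (IsTermFn.proj (Fin.last n)) _)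
  refine h.of_eq fun x => ?_
  have := chiFn_not (fun x => ¬P x) x
  simp only [not_not, Fin.snoc_last] at this ⊢
  exact this.symm

end Presentations

/-! ## Composition `x̄ ↦ G(x̄, H x̄)` (Buss 1990, Thm. 11(a)) -/

section Composition

variable {k n : ℕ}

/-- `x + y ≤ x·y + 1` for `x, y ≥ 1`. [folklore] -/
theorem add_le_mul_add_one {x y : M} (hx : 1 ≤ x) (hy : 1 ≤ y) : x + y ≤ x * y + 1 := by
  obtain ⟨y', rfl⟩ := exists_eq_add_one_of_ne_zero ((one_le_iff_ne_zero' y).1 hy)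
  have h1 : y' ≤ x * y' := by
    calc y' = 1 * y' := (one_mul y').symm
      _ ≤ x * y' := mul_le_mul'' hx le_rfl
  calc x + (y' + 1) = y' + x + 1 := by ring
    _ ≤ x * y' + x + 1 := by gcongr
    _ = x * (y' + 1) + 1 := by ring

/-- `|a| + |b| ≤ |a # b|` when `|a|, |b| ≥ 1` (`|a # b| = |a|·|b| + 1`, axiom 13). [folklore] -/
theorem mLen_add_mLen_le_mLen_mSmash {a b : M} (ha : 1 ≤ mLen a) (hb : 1 ≤ mLen b) :
    mLen a + mLen b ≤ mLen (mSmash a b) := by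
  rw [mLen_mSmash]
  exact add_le_mul_add_one ha hb

/-- A code `< 2ᵐ` all of whose bits at the positions in `[m', m)` vanish is `< 2^{m'}`
(`m' ≤ m ≤ |S|`). [folklore] -/
theorem lt_pow2B_of_seqEl_eq_zero {S m m' v : M} (hm : m ≤ mLen S) (hm' : m' ≤ m)
    (hv : v < pow2B S m) (h : ∀ q, m' ≤ q → q < m → seqEl S 1 v q = 0) : v < pow2B S m' := by
  obtain ⟨d, hd⟩ := exists_add_of_le' hm'
  have hdS : m' + d ≤ mLen S := hd ▸ hm
  have hq : v / pow2B S m' < pow2B S d := div_pow2B_lt (hd ▸ hv) hdS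
  have hdS' : d ≤ mLen S := le_trans (le_add_left'' d m') hdS
  have h0 : v / pow2B S m' = 0 := by
    refine ext_of_seqEl_one hdS' hq (pow2B_pos S d) fun q hqd => ?_
    rw [seqEl_zero, seqEl_one_div_pow2B (by
      calc q + m' + 1 = m' + (q + 1) := by ring
        _ ≤ m' + d := by gcongr; exact (add_one_le_iff' q d).2 hqd
        _ ≤ mLen S := hdS)]
    exact h (q + m') (le_add_left'' m' q) (by rw [hd, add_comm]; gcongr)
  exact (div_eq_zero_iff' (pow2B_pos S m')).1 h0

namespace QPres

variable (PG : QPres M k (n + 1)) (PH : QPres M k n)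

/-- Padded number of queries of the outer function: `L_G(x̄, bnd_H x̄)`. [folklore] -/
noncomputable def cΛ (x : Fin n → M) : M := PG.L (Fin.snoc x (PH.bnd x))

/-- Length bound of the outer function at the padded argument. [folklore] -/
noncomputable def cSG (x : Fin n → M) : M := PG.S (Fin.snoc x (PH.bnd x))

/-- Total number of queries of the composite: `cΛ + L_H`. [folklore] -/
noncomputable def cL (x : Fin n → M) : M := cΛ PG PH x + PH.L x

/-- Length bound of the composite: `cSG # S_H`. [folklore] -/
noncomputable def cS (x : Fin n → M) : M := mSmash (cSG PG PH x) (PH.S x)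

/-- The block of the inner function: the bits at positions `[cΛ, cL)`. [folklore] -/
noncomputable def cTop (x : Fin n → M) (w : M) : M :=
  w % pow2B (cS PG PH x) (cL PG PH x) / pow2B (cS PG PH x) (cΛ PG PH x)

/-- The (padded) block of the outer function: the bits at positions `< cΛ`. [folklore] -/
noncomputable def cBot (x : Fin n → M) (w : M) : M := w % pow2B (cS PG PH x) (cΛ PG PH x)

/-- The computed argument `H x̄ = OUT_H x̄ (inner block)`. [folklore] -/
noncomputable def cY (x : Fin n → M) (w : M) : M := PH.OUT x (cTop PG PH x w)

/-- The queries of the composite: below `cΛ` the queries of `G` at the computed argument (only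
below `L_G` there, `0`-padded above), from `cΛ` on the queries of `H`. [folklore] -/
def cQ (x : Fin n → M) (w p : M) : Prop :=
  (p < cΛ PG PH x ∧ (p < PG.L (Fin.snoc x (cY PG PH x w)) ∧
      PG.Q (Fin.snoc x (cY PG PH x w)) (cBot PG PH x w) p)) ∨
    (cΛ PG PH x ≤ p ∧ PH.Q x (cTop PG PH x w) (p - cΛ PG PH x))

/-- The output of the composite: the output of `G` at the computed argument and its block.
[folklore] -/
noncomputable def cOUT (x : Fin n → M) (w : M) : M :=
  PG.OUT (Fin.snoc x (cY PG PH x w)) (cBot PG PH x w)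

/-! ### Term functions and lengths -/

/-- `cΛ` is a term function. [folklore] -/
theorem isTermFn_cΛ : IsTermFn (cΛ PG PH) := PG.isTermFn_L.snoc PH.isTermFn_bnd

/-- `cSG` is a term function. [folklore] -/
theorem isTermFn_cSG : IsTermFn (cSG PG PH) := PG.isTermFn_S.snoc PH.isTermFn_bnd

/-- `cL` is a term function. [folklore] -/
theorem isTermFn_cL : IsTermFn (cL PG PH) := (isTermFn_cΛ PG PH).add PH.isTermFn_L

/-- `cS` is a term function. [folklore] -/
theorem isTermFn_cS : IsTermFn (cS PG PH) := (isTermFn_cSG PG PH).smash PH.isTermFn_S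

/-- `cΛ ≤ |cSG|`. [folklore] -/
theorem cΛ_le (x : Fin n → M) : cΛ PG PH x ≤ mLen (cSG PG PH x) := PG.L_le _

/-- `1 ≤ |cSG|`. [folklore] -/
theorem one_le_mLen_cSG (x : Fin n → M) : 1 ≤ mLen (cSG PG PH x) := PG.one_le _

/-- `cL ≤ |cS|`: all positions of the composite code are below the length bound. [folklore] -/
theorem cL_le (x : Fin n → M) : cL PG PH x ≤ mLen (cS PG PH x) :=
  (add_le_add (cΛ_le PG PH x) (PH.L_le x)).trans
    (mLen_add_mLen_le_mLen_mSmash (one_le_mLen_cSG PG PH x) (PH.one_le x))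

/-- `|S_H| ≤ |cS|`. [folklore] -/
theorem mLen_SH_le (x : Fin n → M) : mLen (PH.S x) ≤ mLen (cS PG PH x) :=
  le_trans (le_add_left'' _ _)
    (mLen_add_mLen_le_mLen_mSmash (one_le_mLen_cSG PG PH x) (PH.one_le x))

/-- `|cSG| ≤ |cS|`. [folklore] -/
theorem mLen_cSG_le (x : Fin n → M) : mLen (cSG PG PH x) ≤ mLen (cS PG PH x) :=
  le_trans (le_add_right'' _ _)
    (mLen_add_mLen_le_mLen_mSmash (one_le_mLen_cSG PG PH x) (PH.one_le x))

/-- `1 ≤ |cS|`. [folklore] -/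
theorem one_le_mLen_cS (x : Fin n → M) : 1 ≤ mLen (cS PG PH x) :=
  (PH.one_le x).trans (mLen_SH_le PG PH x)

/-- `cΛ ≤ |cS|`. [folklore] -/
theorem cΛ_le_mLen_cS (x : Fin n → M) : cΛ PG PH x ≤ mLen (cS PG PH x) :=
  (cΛ_le PG PH x).trans (mLen_cSG_le PG PH x)

/-- `L_H ≤ |cS|`. [folklore] -/
theorem LH_le_mLen_cS (x : Fin n → M) : PH.L x ≤ mLen (cS PG PH x) :=
  (PH.L_le x).trans (mLen_SH_le PG PH x)

/-- `cL = cΛ + L_H`, additive bookkeeping. [folklore] -/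
theorem cΛ_add (x : Fin n → M) : cΛ PG PH x + PH.L x = cL PG PH x := rfl

/-! ### Bits of the two blocks -/

/-- The inner block is `< 2^{L_H}`. [folklore] -/
theorem cTop_lt (x : Fin n → M) (w : M) : cTop PG PH x w < pow2B (cS PG PH x) (PH.L x) :=
  div_pow2B_lt (by rw [cΛ_add]; exact mod_pow2B_lt _ _ _) (by rw [cΛ_add]; exact cL_le PG PH x)

/-- The outer block is `< 2^{cΛ}`. [folklore] -/
theorem cBot_lt (x : Fin n → M) (w : M) : cBot PG PH x w < pow2B (cS PG PH x) (cΛ PG PH x) :=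
  mod_pow2B_lt _ _ _

/-- Bits of the inner block inside: bit `q` of `cTop w` is bit `q + cΛ` of `w` (`q < L_H`).
[folklore] -/
theorem seqEl_cTop {x : Fin n → M} {q : M} (hq : q < PH.L x) (w : M) :
    seqEl (cS PG PH x) 1 (cTop PG PH x w) q = seqEl (cS PG PH x) 1 w (q + cΛ PG PH x) := by
  have h1 : q + cΛ PG PH x < cL PG PH x := by
    rw [← cΛ_add, add_comm]; gcongr
  rw [cTop, seqEl_one_div_pow2B (((add_one_le_iff' _ _).2 h1).trans (cL_le PG PH x)),
    seqEl_one_mod_pow2B h1 (cL_le PG PH x)]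

/-- Bits of the inner block outside vanish: bit `q` of `cTop w` is `0` for `q ≥ L_H`. [folklore] -/
theorem seqEl_cTop_eq_zero {x : Fin n → M} {q : M} (hq : PH.L x ≤ q) (w : M) :
    seqEl (cS PG PH x) 1 (cTop PG PH x w) q = 0 :=
  seqEl_one_eq_zero_of_lt' (cTop_lt PG PH x w) (LH_le_mLen_cS PG PH x) hq

/-- Bits of the outer block inside: bit `q` of `cBot w` is bit `q` of `w` (`q < cΛ`). [folklore] -/
theorem seqEl_cBot {x : Fin n → M} {q : M} (hq : q < cΛ PG PH x) (w : M) :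
    seqEl (cS PG PH x) 1 (cBot PG PH x w) q = seqEl (cS PG PH x) 1 w q :=
  seqEl_one_mod_pow2B hq (cΛ_le_mLen_cS PG PH x) w

/-- Bits of the outer block outside vanish: bit `q` of `cBot w` is `0` for `q ≥ cΛ`. [folklore] -/
theorem seqEl_cBot_eq_zero {x : Fin n → M} {q : M} (hq : cΛ PG PH x ≤ q) (w : M) :
    seqEl (cS PG PH x) 1 (cBot PG PH x w) q = 0 :=
  seqEl_one_eq_zero_of_lt' (cBot_lt PG PH x w) (cΛ_le_mLen_cS PG PH x) hq

/-- **The inner block depends only on the bits above any `p < cΛ`**: if two codes have the same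
bits at all positions `q > p` below `|cS|`, their inner blocks coincide. [folklore] -/
theorem cTop_eq_of_bits {x : Fin n → M} {w w' p : M} (hp : p < cΛ PG PH x)
    (h : ∀ q, p < q → q + 1 ≤ mLen (cS PG PH x) → seqEl (cS PG PH x) 1 w q = seqEl (cS PG PH x) 1 w' q) :
    cTop PG PH x w = cTop PG PH x w' := by
  refine ext_of_seqEl_one (LH_le_mLen_cS PG PH x) (cTop_lt PG PH x w) (cTop_lt PG PH x w')
    fun q hq => ?_
  rw [seqEl_cTop PG PH hq, seqEl_cTop PG PH hq]
  refine h _ (lt_of_lt_of_le hp (le_add_left'' _ _)) ?_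
  have h1 : q + cΛ PG PH x < cL PG PH x := by
    rw [← cΛ_add, add_comm]; gcongr
  exact ((add_one_le_iff' _ _).2 h1).trans (cL_le PG PH x)

/-! ### The composite presentation -/

/-- `cTop` is a uniformly definable output function. [folklore] -/
theorem isSigmabOut_cTop : IsSigmabOut k (cTop PG PH) :=
  IsSigmabOut.divPow2B (IsSigmabOut.args (isTermFn_cS PG PH))
    (IsSigmabOut.args (isTermFn_cΛ PG PH))
    (IsSigmabOut.modPow2B (IsSigmabOut.args (isTermFn_cS PG PH))
      (IsSigmabOut.args (isTermFn_cL PG PH)) IsSigmabOut.code)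

/-- `cBot` is a uniformly definable output function. [folklore] -/
theorem isSigmabOut_cBot : IsSigmabOut k (cBot PG PH) :=
  IsSigmabOut.modPow2B (IsSigmabOut.args (isTermFn_cS PG PH))
    (IsSigmabOut.args (isTermFn_cΛ PG PH)) IsSigmabOut.code

/-- `cY` is a uniformly definable output function. [folklore] -/
theorem isSigmabOut_cY : IsSigmabOut k (cY PG PH) :=
  PH.isSigmabOut.substCode (isSigmabOut_cTop PG PH)

/-- The queries of the composite are `Σᵇₖ₊₁`-definable uniformly. [folklore] -/
theorem isSigmabQuery_cQ : IsSigmabQuery k (cQ PG PH) := by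
  have hΛ : IsSigmabOut k fun (x : Fin n → M) (_ : M) => cΛ PG PH x :=
    IsSigmabOut.args (isTermFn_cΛ PG PH)
  have h1 : IsSigmabQuery k fun x w p => p < cΛ PG PH x := IsSigmabQuery.pos_lt hΛ
  have hLG : IsSigmabOut k fun x w => PG.L (Fin.snoc x (cY PG PH x w)) :=
    (IsSigmabOut.args (k := k) PG.isTermFn_L).snocArg (isSigmabOut_cY PG PH) IsSigmabOut.code
  have h2 : IsSigmabQuery k fun x w p => p < PG.L (Fin.snoc x (cY PG PH x w)) :=
    IsSigmabQuery.pos_lt hLG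
  have h3 : IsSigmabQuery k fun x w p => PG.Q (Fin.snoc x (cY PG PH x w)) (cBot PG PH x w) p :=
    PG.isSigmabQuery.snocArg (isSigmabOut_cY PG PH) (isSigmabOut_cBot PG PH)
  have h4 : IsSigmabQuery k fun x (_ : M) p => cΛ PG PH x ≤ p :=
    IsSigmabQuery.of_isQFDef ((IsQFDef.le (isTermFn_init_init (isTermFn_cΛ PG PH))
      (IsTermFn.proj (Fin.last (n + 1)))).of_iff fun u => by simp [mLe_iff])
  have h5 : IsSigmabQuery k fun x w p => PH.Q x (cTop PG PH x w) (p - cΛ PG PH x) :=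
    PH.isSigmabQuery.substCodePos (isSigmabOut_cTop PG PH)
      (isSigmabFn_sub (IsTermFn.proj (Fin.last (n + 1))) (isTermFn_init_init (isTermFn_cΛ PG PH)) _)
  exact (h1.and (h2.and h3)).or (h4.and h5)

/-- The queries of the composite are causal. [folklore] -/
theorem isCausal_cQ (x : Fin n → M) : IsCausal₁ (cQ PG PH x) (cS PG PH x) := by
  intro w w' p hbits
  rcases lt_or_ge p (cΛ PG PH x) with hp | hp
  · -- below `cΛ`: the queries of `G` at the computed argument, which is the same for `w, w'`
    have hY : cY PG PH x w = cY PG PH x w' := by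
      rw [cY, cY, cTop_eq_of_bits PG PH hp hbits]
    simp only [cQ, hp, true_and, not_le.2 hp, false_and, or_false, hY]
    refine and_congr_right fun _ => ?_
    refine PG.isCausal (Fin.snoc x (cY PG PH x w')) _ _ p fun q hpq hqS => ?_
    -- bits of the two outer blocks at `q > p`, read under the length bound `S_G(x̄, y)`
    set SG := PG.S (Fin.snoc x (cY PG PH x w')) with hSG
    rcases lt_or_ge q (cΛ PG PH x) with hq | hq
    · have hqS' : q + 1 ≤ mLen (cS PG PH x) :=
        ((add_one_le_iff' _ _).2 hq).trans (cΛ_le_mLen_cS PG PH x)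
      rw [← seqEl_one_congr hqS' hqS, ← seqEl_one_congr hqS' hqS, seqEl_cBot PG PH hq,
        seqEl_cBot PG PH hq]
      exact hbits q hpq hqS'
    · -- here `cΛ ≤ q < |SG|`, so both blocks (`< 2^{cΛ}`) have bit `0`
      have hΛS : cΛ PG PH x ≤ mLen SG :=
        hq.trans ((le_add_right'' q 1).trans hqS)
      have hb : pow2B (cS PG PH x) (cΛ PG PH x) = pow2B SG (cΛ PG PH x) :=
        pow2B_congr (cΛ_le_mLen_cS PG PH x) hΛS
      rw [seqEl_one_eq_zero_of_lt' (hb ▸ cBot_lt PG PH x w) hΛS hq,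
        seqEl_one_eq_zero_of_lt' (hb ▸ cBot_lt PG PH x w') hΛS hq]
  · -- from `cΛ` on: the queries of `H` about the inner blocks, which agree above `p - cΛ`
    have hiff : PH.Q x (cTop PG PH x w) (p - cΛ PG PH x) ↔
        PH.Q x (cTop PG PH x w') (p - cΛ PG PH x) := by
      refine PH.isCausal x _ _ _ fun q hpq hqS => ?_
      have hqS' : q + 1 ≤ mLen (cS PG PH x) := hqS.trans (mLen_SH_le PG PH x)
      rw [← seqEl_one_congr hqS' hqS, ← seqEl_one_congr hqS' hqS]
      rcases lt_or_ge q (PH.L x) with hq | hq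
      · rw [seqEl_cTop PG PH hq, seqEl_cTop PG PH hq]
        refine hbits _ ?_ ?_
        · have := (tsub_lt_iff_left hp).1 hpq
          rwa [add_comm] at this
        · have h1 : q + cΛ PG PH x < cL PG PH x := by
            rw [← cΛ_add, add_comm]; gcongr
          exact ((add_one_le_iff' _ _).2 h1).trans (cL_le PG PH x)
      · rw [seqEl_cTop_eq_zero PG PH hq, seqEl_cTop_eq_zero PG PH hq]
    simp only [cQ, not_lt.2 hp, false_and, false_or, hp, true_and, hiff]

/-- The output of the composite is `Σᵇₖ₊₁`-definable uniformly. [folklore] -/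
theorem isSigmabOut_cOUT : IsSigmabOut k (cOUT PG PH) :=
  PG.isSigmabOut.snocArg (isSigmabOut_cY PG PH) (isSigmabOut_cBot PG PH)

/-- **The presentation of the composite `x̄ ↦ G(x̄, H x̄)`** (Buss 1990, Thm. 11(a): first the
queries of `H`, then those of `G` at the value obtained). [cite: BussContempMath1990, Thm. 11(a)] -/
noncomputable def comp₁ : QPres M k n where
  L := cL PG PH
  S := cS PG PH
  Q := cQ PG PH
  OUT := cOUT PG PH
  isTermFn_L := isTermFn_cL PG PH
  isTermFn_S := isTermFn_cS PG PH
  L_le := cL_le PG PH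
  one_le := one_le_mLen_cS PG PH
  isSigmabQuery := isSigmabQuery_cQ PG PH
  isCausal := isCausal_cQ PG PH
  isSigmabOut := isSigmabOut_cOUT PG PH

/-! ### Correctness of the composite presentation -/

/-- **Block lemma**: a block of an answer code whose bits are bits of the code and whose queries
are the corresponding queries of the code is an answer code (for the block's query family).
[folklore] -/
theorem _root_.Literature.Computability.MetaComplexity.BASICModel.IsAnswerCode.block
    {Q : M → M → Prop} {S L W : M} (hW : IsAnswerCode Q S L W) {Q' : M → M → Prop}
    {S' L' off blk : M} (hoff : off + L' ≤ L) (hlt : blk < pow2B S' L')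
    (hbits : ∀ p, p < L' → seqEl S' 1 blk p = seqEl S 1 W (p + off))
    (hiff : ∀ p, p < L' → (Q W (p + off) ↔ Q' blk p)) : IsAnswerCode Q' S' L' blk := by
  refine ⟨hlt, fun p hp => ?_⟩
  rw [hbits p hp, ← hiff p hp]
  refine hW.2 (p + off) (lt_of_lt_of_le ?_ hoff)
  rw [add_comm off]; gcongr

variable {PG PH}

/-- The inner block of the answer code of the composite is the answer code of `H`. [folklore] -/
theorem cTop_code (hIk : M ⊨ INDScheme (sigmabFormulas (k + 1))) (x : Fin n → M) :
    cTop PG PH x ((comp₁ PG PH).code x) = PH.code x := by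
  have hW := (comp₁ PG PH).isAnswerCode_code hIk x
  refine PH.eq_code (hW.block (off := cΛ PG PH x) (le_of_eq (cΛ_add PG PH x)) ?_ ?_ ?_)
  · rw [← pow2B_congr (LH_le_mLen_cS PG PH x) (PH.L_le x)]
    exact cTop_lt PG PH x _
  · intro p hp
    rw [← seqEl_one_congr (((add_one_le_iff' _ _).2 hp).trans (LH_le_mLen_cS PG PH x))
      (((add_one_le_iff' _ _).2 hp).trans (PH.L_le x))]
    exact seqEl_cTop PG PH hp _
  · intro p hp
    change cQ PG PH x _ (p + cΛ PG PH x) ↔ _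
    simp only [cQ, add_tsub_cancel_right, le_add_left'', true_and]
    constructor
    · rintro (⟨h, -⟩ | h)
      · exact ((not_lt.2 (le_add_left'' (cΛ PG PH x) p)) h).elim
      · exact h
    · exact fun h => Or.inr h

/-- The computed argument is the value `H x̄`. [folklore] -/
theorem cY_code (hIk : M ⊨ INDScheme (sigmabFormulas (k + 1))) (x : Fin n → M) :
    cY PG PH x ((comp₁ PG PH).code x) = PH.eval x := by
  rw [cY, cTop_code hIk, QPres.eval]

/-- The number of queries of `G` at the actual argument is at most the padded number. [folklore] -/
theorem LG_le_cΛ (x : Fin n → M) : PG.L (Fin.snoc x (PH.eval x)) ≤ cΛ PG PH x :=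
  PG.isTermFn_L.monotone (snoc_le_snoc (fun _ => le_rfl) (PH.eval_le_bnd x))

/-- The outer block of the answer code of the composite is the answer code of `G` at `(x̄, H x̄)`.
[folklore] -/
theorem cBot_code (hIk : M ⊨ INDScheme (sigmabFormulas (k + 1))) (x : Fin n → M) :
    cBot PG PH x ((comp₁ PG PH).code x) = PG.code (Fin.snoc x (PH.eval x)) := by
  have hW := (comp₁ PG PH).isAnswerCode_code hIk x
  set W := (comp₁ PG PH).code x with hWdef
  set y₀ := PH.eval x with hy₀
  have hY : cY PG PH x W = y₀ := cY_code hIk x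
  have hLG : PG.L (Fin.snoc x y₀) ≤ cΛ PG PH x := LG_le_cΛ x
  have hS1 : 1 ≤ mLen (cS PG PH x) := one_le_mLen_cS PG PH x
  -- the padding bits of `W` (positions in `[L_G(x̄, y₀), cΛ)`) vanish
  have hpad : ∀ q, PG.L (Fin.snoc x y₀) ≤ q → q < cΛ PG PH x → seqEl (cS PG PH x) 1 W q = 0 := by
    intro q hq1 hq2
    refine hW.bit_eq_zero hS1 (lt_of_lt_of_le hq2 ?_) ?_
    · exact le_add_right'' _ _
    · change ¬cQ PG PH x W q
      simp only [cQ, hY, not_or, not_and]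
      exact ⟨fun _ h => ((not_le.2 h) hq1).elim, fun h => ((not_le.2 hq2) h).elim⟩
  refine PG.eq_code (hW.block (off := 0) (L' := PG.L (Fin.snoc x y₀)) ?_ ?_ ?_ ?_)
  · rw [zero_add]
    exact hLG.trans (le_add_right'' (cΛ PG PH x) (PH.L x))
  · rw [← pow2B_congr (hLG.trans (cΛ_le_mLen_cS PG PH x)) (PG.L_le _)]
    refine lt_pow2B_of_seqEl_eq_zero (cΛ_le_mLen_cS PG PH x) hLG (cBot_lt PG PH x W) ?_
    intro q hq1 hq2
    rw [seqEl_cBot PG PH hq2]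
    exact hpad q hq1 hq2
  · intro p hp
    have hpΛ : p < cΛ PG PH x := lt_of_lt_of_le hp hLG
    rw [add_zero, ← seqEl_one_congr (((add_one_le_iff' _ _).2 hpΛ).trans (cΛ_le_mLen_cS PG PH x))
      (((add_one_le_iff' _ _).2 hp).trans (PG.L_le _))]
    exact seqEl_cBot PG PH hpΛ W
  · intro p hp
    have hpΛ : p < cΛ PG PH x := lt_of_lt_of_le hp hLG
    rw [add_zero]
    change cQ PG PH x W p ↔ _
    simp only [cQ, hY, hpΛ, hp, true_and, not_le.2 hpΛ, false_and, or_false]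

/-- **Value of the composite presentation**: `G(x̄, H x̄)` (Buss 1990, Thm. 11(a)).
[cite: BussContempMath1990, Thm. 11(a)] -/
theorem eval_comp₁ (hIk : M ⊨ INDScheme (sigmabFormulas (k + 1))) (x : Fin n → M) :
    (comp₁ PG PH).eval x = PG.eval (Fin.snoc x (PH.eval x)) := by
  change cOUT PG PH x ((comp₁ PG PH).code x) = _
  rw [cOUT, cY_code hIk, cBot_code hIk]
  rfl

end QPres

/-- **Composition** (Buss 1990, Thm. 11(a), semantically): if `G` (arity `n + 1`) and `H`
(arity `n`) are query-presentable at level `k + 1` in a model of `BASIC + Σᵇ₁-IND + Σᵇₖ₊₁-IND`,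
then so is `x̄ ↦ G(x̄, H x̄)`. [cite: BussContempMath1990, Thm. 11(a)] -/
theorem IsQFn.comp₁ (hIk : M ⊨ INDScheme (sigmabFormulas (k + 1))) {G : (Fin (n + 1) → M) → M}
    (hG : IsQFn k G) {H : (Fin n → M) → M} (hH : IsQFn k H) :
    IsQFn k fun x => G (Fin.snoc x (H x)) := by
  obtain ⟨PG, hPG⟩ := hG
  obtain ⟨PH, hPH⟩ := hH
  exact ⟨PG.comp₁ PH, fun x => by rw [QPres.eval_comp₁ hIk, ← hPH, ← hPG]⟩

/-- **Composition with several inner functions, one at a time**: `x̄ ↦ G(x̄, H₁ x̄, H₂ x̄)`.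
[cite: BussContempMath1990, Thm. 11(a)] -/
theorem IsQFn.comp₂ (hIk : M ⊨ INDScheme (sigmabFormulas (k + 1))) {G : (Fin (n + 2) → M) → M}
    (hG : IsQFn k G) {H₁ H₂ : (Fin n → M) → M} (hH₁ : IsQFn k H₁) (hH₂ : IsQFn k H₂) :
    IsQFn k fun x => G (Fin.snoc (Fin.snoc x (H₁ x)) (H₂ x)) := by
  have h2 : IsQFn k fun v : Fin (n + 1) → M => H₂ (Fin.init v) := hH₂.relabel Fin.castSucc
  have h := (hG.comp₁ hIk h2).comp₁ hIk hH₁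
  exact h.of_eq fun x => by simp

end Composition

end BASICModel

end Literature.Computability.MetaComplexity
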